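import Summits.AnomalousDissipation.AnomalousDissipation.Theorems.SawtoothPulseCascadeApproxProfileDeriv
import Summits.AnomalousDissipation.AnomalousDissipation.Theorems.SawtoothPulseCascadeApproxRealign

/-!
# The realigned comb profile with its Lipschitz size
(route `AnomalousDissipation/SawtoothPulseCascade`; helper for the crux ApproxSol58 =
stmt-AnomalousDissipation-19688, S2 `stub_responseLipEnvelope` of the lead's reshaped line `linear-response-lip`)

`…ApproxRealign.exists_realigned` produces, for a slot `[a, a + τ]` with budget `8π²νN²τ < δ²`, a smooth `1`-periodic
residual comb `g` (Fourier support on the odd multiples of `N`, `|g| ≤ 6√(2π) ν N (∫|r|)/δ'`,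
`δ' = √(δ² − 8π²νN²τ)`) whose homogeneous heat flow over the slot ends at the slot's forced parallel profile.  The per-phase
LIPSCHITZ cap `K2LipschitzGrowthClassical` measures a comb datum by `D₁ + (N/δ) D₀` with `D₁ ≥ sup |g'|`, so the Lipschitz
pipeline needs the same `g` WITH a derivative bound.  Since `g` is itself a forced profile (of the sharper source, evaluated at
the slot end), `…ApproxProfileDeriv.abs_deriv_forcedProfile_le` gives `|g'| ≤ 24π√(2π) ν N² (∫|r|) / δ'²`.  This file
re-runs the construction of `exists_realigned` recording that bound (`exists_realigned_lip`), and specialises it to the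
cascade's H and V half-slots (`exists_realigned_lip_H/_V`, `∫|rate| = γ`).
-/

set_option linter.dupNamespace false

noncomputable section

namespace Summit.AnomalousDissipation.AnomalousDissipation.Theorems.SawtoothPulseCascade.ApproxResponse

open Set MeasureTheory
open scoped ContDiff
open Literature.Analysis Literature.Analysis.FunctionSpaces Literature.Analysis.FluidPDE
open Literature.Analysis.FluidPDE.SawtoothCascade
open Summit.AnomalousDissipation.AnomalousDissipation.Theorems.SawtoothPulseCascade.K2Classical

/-- **The realigned comb profile, with its Lipschitz size.**  For a slot `[a, a + τ]` (`τ > 0`, `ν > 0`) with smooth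
rate `r`, profile width `δ > 0`, frequency `N ≠ 0` and budget `8π²νN²τ < δ²` there is a smooth `1`-periodic `g` with:
(i) Fourier support on the odd multiples of `N`; (ii) `|g(y)| ≤ 6√(2π) ν N (∫ₐ^{a+τ}|r|) / δ'`,
`δ' = √(δ² − 8π²νN²τ)`; (ii') `|g'(y)| ≤ 24π√(2π) ν N² (∫ₐ^{a+τ}|r|) / δ'²`; (iii) REALIGNMENT: the homogeneous heat
profile over the slot started from `g` ends at `F(a + τ)` for every forced profile `F` from zero with the heat-lag source
`r(t) · ν u_δ''(y)`, `u_δ(y) = roundedSaw δ (2πNy)/(2πN)`.  (Same witness as `exists_realigned`: the forced profile of the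
SHARPER source `u_{δ'}` at the slot end.) -/
theorem exists_realigned_lip {δ : ℝ} (hδ : 0 < δ) {N : ℕ} (hN : N ≠ 0) {ν a τ : ℝ} (hν : 0 < ν) (hτ : 0 < τ)
    (hbud : 8 * Real.pi ^ 2 * ν * (N : ℝ) ^ 2 * τ < δ ^ 2) {r : ℝ → ℝ} (hr : ContDiff ℝ ∞ r) :
    ∃ g : ℝ → ℝ, ContDiff ℝ ∞ g ∧ Function.Periodic g 1 ∧
      (∀ m : ℤ, (¬ ∃ n : ℤ, m = (2 * n + 1) * (N : ℤ)) →
        fourierCoeff (AddCircle.liftIco 1 0 fun y => (g y : ℂ)) m = 0) ∧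
      (∀ y, |g y| ≤ 6 * Real.sqrt (2 * Real.pi) * ν * N * (∫ s in a..(a + τ), |r s|) /
        Real.sqrt (δ ^ 2 - 8 * Real.pi ^ 2 * ν * (N : ℝ) ^ 2 * τ)) ∧
      (∀ y, |deriv g y| ≤ 24 * Real.pi * Real.sqrt (2 * Real.pi) * ν * (N : ℝ) ^ 2 * (∫ s in a..(a + τ), |r s|) /
        (δ ^ 2 - 8 * Real.pi ^ 2 * ν * (N : ℝ) ^ 2 * τ)) ∧
      (∀ c F : ℝ → ℝ → ℝ,
        ContDiffOn ℝ ∞ (Function.uncurry c) (Icc a (a + τ) ×ˢ univ) →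
        (∀ t ∈ Icc a (a + τ), Function.Periodic (c t) 1) →
        (∀ t ∈ Icc a (a + τ), ∀ y, derivWithin (fun s => c s y) (Icc a (a + τ)) t =
          ν * deriv (deriv (c t)) y) →
        c a = g →
        ContDiffOn ℝ ∞ (Function.uncurry F) (Icc a (a + τ) ×ˢ univ) →
        (∀ t ∈ Icc a (a + τ), Function.Periodic (F t) 1) → F a = (fun _ => 0) →
        (∀ t ∈ Icc a (a + τ), ∀ y, derivWithin (fun s => F s y) (Icc a (a + τ)) t =
          ν * deriv (deriv (F t)) y + r t * (ν * deriv (deriv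
            (fun y : ℝ => roundedSaw δ (2 * Real.pi * N * y) / (2 * Real.pi * N))) y)) →
        c (a + τ) = F (a + τ)) := by
  have hab : a < a + τ := by linarith
  have hδ' := sharpWidth_pos hbud
  have hb : a + τ ∈ Icc a (a + τ) := right_mem_Icc.2 hab.le
  -- the sharper source and its forced profile from zero
  set us : ℝ → ℝ := fun y => roundedSaw (Real.sqrt (δ ^ 2 - 8 * Real.pi ^ 2 * ν * (N : ℝ) ^ 2 * τ))
    (2 * Real.pi * N * y) / (2 * Real.pi * N) with hus
  have hVs : ContDiff ℝ ∞ (fun y : ℝ => ν * deriv (deriv us) y) := by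
    have := (contDiff_profile hδ' N).iterate_deriv 2
    simpa [hus] using contDiff_const.mul this
  have hVsper : Function.Periodic (fun y : ℝ => ν * deriv (deriv us) y) 1 := fun y => by
    simp only [hus, (ShearCascade.periodic_deriv (ShearCascade.periodic_deriv
      (periodic_profile (Real.sqrt (δ ^ 2 - 8 * Real.pi ^ 2 * ν * (N : ℝ) ^ 2 * τ)) N))) y]
  obtain ⟨Fs, hFs, hFsper, heatFs, hFs0⟩ := exists_heatProfile_forced hab hν
    (g := fun _ : ℝ => (0 : ℝ)) contDiff_const (fun _ => rfl) (σ := fun t y => r t * (ν * deriv (deriv us) y))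
    (contDiffOn_uncurry_mul_sep hr hVs _) (fun t _ y => by simp only [hVsper y])
  refine ⟨Fs (a + τ), contDiff_slice_of_contDiffOn_uncurry hFs hb, hFsper _ hb, fun m hm => ?_, fun y => ?_,
    fun y => ?_, fun c F hc hcper heatc hca hF hFper hF0 heatF => ?_⟩
  · exact fourierCoeff_forcedProfile_eq_zero hδ' hN hab hFs hFsper hFs0 hr heatFs hm hb
  · have h := abs_forcedProfile_le hδ' hN hab hν.le hFs hFsper hFs0 hr heatFs hb y
    rwa [abs_of_pos hν] at h
  · have h := abs_deriv_forcedProfile_le hδ' hN hab hν.le hFs hFsper hFs0 hr heatFs hb y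
    rwa [abs_of_pos hν, sharpWidth_sq hbud] at h
  · exact realign_eq hδ hN hτ hbud hr ν hF hFper hF0 heatF hFs hFsper hFs0 heatFs hc hcper heatc hca

open Literature.Analysis.FluidPDE.SawtoothCascade.CascadeParams

/-- **Realigned comb profile of the H half-slot of phase `j`, with its Lipschitz size.**  As
`exists_realigned_H` (`δ₀ > 0`, `d > 0`, `γ ≥ 0`, `N_j ≠ 0`, `ν > 0`, budget `8π²νN_j² tHalf_j < δ_j²`), recording in
addition `|g'| ≤ 24π√(2π) ν N_j² γ / δ'_j²`, `δ'_j² = δ_j² − 8π²νN_j² tHalf_j`. -/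
theorem exists_realigned_lip_H (P : CascadeParams) (hδ₀ : 0 < P.δ₀) (hd : 0 < P.d) (hγ : 0 ≤ P.γ) {j : ℕ}
    (hN : P.N j ≠ 0) {ν : ℝ} (hν : 0 < ν)
    (hbud : 8 * Real.pi ^ 2 * ν * (P.N j : ℝ) ^ 2 * tHalf j < P.δ j ^ 2) :
    ∃ g : ℝ → ℝ, ContDiff ℝ ∞ g ∧ Function.Periodic g 1 ∧
      (∀ m : ℤ, (¬ ∃ n : ℤ, m = (2 * n + 1) * (P.N j : ℤ)) →
        fourierCoeff (AddCircle.liftIco 1 0 fun y => (g y : ℂ)) m = 0) ∧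
      (∀ y, |g y| ≤ 6 * Real.sqrt (2 * Real.pi) * ν * (P.N j) * P.γ /
        Real.sqrt (P.δ j ^ 2 - 8 * Real.pi ^ 2 * ν * (P.N j : ℝ) ^ 2 * tHalf j)) ∧
      (∀ y, |deriv g y| ≤ 24 * Real.pi * Real.sqrt (2 * Real.pi) * ν * (P.N j : ℝ) ^ 2 * P.γ /
        (P.δ j ^ 2 - 8 * Real.pi ^ 2 * ν * (P.N j : ℝ) ^ 2 * tHalf j)) ∧
      (∀ c F : ℝ → ℝ → ℝ,
        ContDiffOn ℝ ∞ (Function.uncurry c) (Icc (tStart j) (tStart j + tHalf j) ×ˢ univ) →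
        (∀ t ∈ Icc (tStart j) (tStart j + tHalf j), Function.Periodic (c t) 1) →
        (∀ t ∈ Icc (tStart j) (tStart j + tHalf j), ∀ y,
          derivWithin (fun s => c s y) (Icc (tStart j) (tStart j + tHalf j)) t = ν * deriv (deriv (c t)) y) →
        c (tStart j) = g →
        ContDiffOn ℝ ∞ (Function.uncurry F) (Icc (tStart j) (tStart j + tHalf j) ×ˢ univ) →
        (∀ t ∈ Icc (tStart j) (tStart j + tHalf j), Function.Periodic (F t) 1) → F (tStart j) = (fun _ => 0) →
        (∀ t ∈ Icc (tStart j) (tStart j + tHalf j), ∀ y,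
          derivWithin (fun s => F s y) (Icc (tStart j) (tStart j + tHalf j)) t =
            ν * deriv (deriv (F t)) y + ν * (P.rateH j t * deriv (deriv (P.U j)) y)) →
        c (tStart j + tHalf j) = F (tStart j + tHalf j)) := by
  have hδ := P.δ_pos hδ₀ hd j
  obtain ⟨g, hg, hgper, hcomb, hbound, hderiv, hreal⟩ :=
    exists_realigned_lip hδ hN hν (tHalf_pos j) hbud (P.contDiff_rateH j) (a := tStart j)
  refine ⟨g, hg, hgper, hcomb, fun y => ?_, fun y => ?_, fun c F hc hcper heatc hca hF hFper hF0 heatF => ?_⟩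
  · have h := hbound y
    rwa [integral_abs_rateH P hγ j] at h
  · have h := hderiv y
    rwa [integral_abs_rateH P hγ j] at h
  · refine hreal c F hc hcper heatc hca hF hFper hF0 fun t ht y => ?_
    rw [heatF t ht y, cascade_U_eq]
    ring

/-- **Realigned comb profile of the V half-slot of phase `j`, with its Lipschitz size** (as `exists_realigned_lip_H`,
on `[tStart j + tHalf j, tStart (j+1)]` with the rate `rateV_j`). -/
theorem exists_realigned_lip_V (P : CascadeParams) (hδ₀ : 0 < P.δ₀) (hd : 0 < P.d) (hγ : 0 ≤ P.γ) {j : ℕ}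
    (hN : P.N j ≠ 0) {ν : ℝ} (hν : 0 < ν)
    (hbud : 8 * Real.pi ^ 2 * ν * (P.N j : ℝ) ^ 2 * tHalf j < P.δ j ^ 2) :
    ∃ g : ℝ → ℝ, ContDiff ℝ ∞ g ∧ Function.Periodic g 1 ∧
      (∀ m : ℤ, (¬ ∃ n : ℤ, m = (2 * n + 1) * (P.N j : ℤ)) →
        fourierCoeff (AddCircle.liftIco 1 0 fun y => (g y : ℂ)) m = 0) ∧
      (∀ y, |g y| ≤ 6 * Real.sqrt (2 * Real.pi) * ν * (P.N j) * P.γ /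
        Real.sqrt (P.δ j ^ 2 - 8 * Real.pi ^ 2 * ν * (P.N j : ℝ) ^ 2 * tHalf j)) ∧
      (∀ y, |deriv g y| ≤ 24 * Real.pi * Real.sqrt (2 * Real.pi) * ν * (P.N j : ℝ) ^ 2 * P.γ /
        (P.δ j ^ 2 - 8 * Real.pi ^ 2 * ν * (P.N j : ℝ) ^ 2 * tHalf j)) ∧
      (∀ c F : ℝ → ℝ → ℝ,
        ContDiffOn ℝ ∞ (Function.uncurry c) (Icc (tStart j + tHalf j) (tStart (j + 1)) ×ˢ univ) →
        (∀ t ∈ Icc (tStart j + tHalf j) (tStart (j + 1)), Function.Periodic (c t) 1) →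
        (∀ t ∈ Icc (tStart j + tHalf j) (tStart (j + 1)), ∀ y,
          derivWithin (fun s => c s y) (Icc (tStart j + tHalf j) (tStart (j + 1))) t = ν * deriv (deriv (c t)) y) →
        c (tStart j + tHalf j) = g →
        ContDiffOn ℝ ∞ (Function.uncurry F) (Icc (tStart j + tHalf j) (tStart (j + 1)) ×ˢ univ) →
        (∀ t ∈ Icc (tStart j + tHalf j) (tStart (j + 1)), Function.Periodic (F t) 1) →
        F (tStart j + tHalf j) = (fun _ => 0) →
        (∀ t ∈ Icc (tStart j + tHalf j) (tStart (j + 1)), ∀ y,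
          derivWithin (fun s => F s y) (Icc (tStart j + tHalf j) (tStart (j + 1))) t =
            ν * deriv (deriv (F t)) y + ν * (P.rateV j t * deriv (deriv (P.U j)) y)) →
        c (tStart (j + 1)) = F (tStart (j + 1))) := by
  have hδ := P.δ_pos hδ₀ hd j
  have hend : tStart j + tHalf j + tHalf j = tStart (j + 1) := by rw [tStart_succ]; ring
  obtain ⟨g, hg, hgper, hcomb, hbound, hderiv, hreal⟩ :=
    exists_realigned_lip hδ hN hν (tHalf_pos j) hbud (P.contDiff_rateV j) (a := tStart j + tHalf j)
  rw [hend] at hbound hderiv hreal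
  refine ⟨g, hg, hgper, hcomb, fun y => ?_, fun y => ?_, fun c F hc hcper heatc hca hF hFper hF0 heatF => ?_⟩
  · have h := hbound y
    rwa [← hend, integral_abs_rateV P hγ j] at h
  · have h := hderiv y
    rwa [← hend, integral_abs_rateV P hγ j] at h
  · refine hreal c F hc hcper heatc hca hF hFper hF0 fun t ht y => ?_
    rw [heatF t ht y, cascade_U_eq]
    ring

end Summit.AnomalousDissipation.AnomalousDissipation.Theorems.SawtoothPulseCascade.ApproxResponse

end
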